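import Literature.FieldTheory.FunctionField.RationalFixingGroup
import Literature.FieldTheory.FunctionField.RationalPolynomialDecompositions
import Mathlib.Algebra.CharP.Lemmas
import HarnessLib

/-!
# Right components from subgroups of the fixing group, and the worked examples `G(u² + u⁻²) = {u, −u, 1/u, −1/u}`,
# `G(u²)` (Gutierrez–Sevilla §3: Def. 4 example, Thm 7, proof of Thm 8)

Topic `Literature/FieldTheory/FunctionField`; namespace `Literature.FieldTheory.FunctionField`.  Lane
`lit-hodgefound` (Track 2 foundations library), seat p01 gen 26, row g26-#4.  THEOREMS ONLY (no definition, no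
named fact, no instance, no notation; D-0014/D-0026, net Literature debt 0).  Sequel BY IMPORT of g26-#3
`RationalFixingGroup` (`G(f) = (K(f)).fixingSubgroup`, `mem_fixingSubgroup_adjoin_iff`, Artin `exists_fixedField_eq_adjoin`,
`card_fixingSubgroup_adjoin_le`, `card_fixingSubgroup_adjoin_eq_iff_isGalois`, `algEquiv_ext_of_apply_X_eq`), g26-#2
(`natDegree_num_inv_and_denom_inv`), g26-#1 (`isCoatom_adjoin_iff`, `adjoin_eq_top_iff_max_natDegree_eq_one`), g25-#9
(`adjoin_le_adjoin_iff_exists_ratFuncSubst`), g24-#10 (`num_div_eq_of_isCoprime`), g22 (`ratFuncSubst_surjective_iff`)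
and Mathlib (`Set.eq_of_subset_of_ncard_le`, `sub_pow_char`) — REUSED, nothing restated.

## Sources, VERBATIM

J. Gutierrez, D. Sevilla [GutierrezSevilla2008] (held `paper:arxiv-0804.1687`), §3 p0005, after Definition 4:
«(i) Let `f = x² + 1/x² ∈ K(x)`. Then `G(f) = {x, −x, 1/x, −1/x}`.»; Theorem 7 «(i) For any non-constant `f ∈ K(x)`,
`|G(f)|` divides `deg f`. […] (ii) If `|G(f)| = deg f` then `K(f) ⊆ K(x)` is normal. Moreover, if the extension
`K(f) ⊆ K(x)` is separable, then `K(f) ⊆ K(x)` is normal ⇒ `|G(f)| = deg f`.»; proof of Theorem 8: «If `1 < |G(f)| <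
deg f`, we have `K(f) ⊊ K(Fix(G(f))) ⊊ K(x)` and any generator of `K(Fix(G(f)))` is a proper component of `f` on the
right. […] there exists `H ⪇ G(f)` not trivial, and again any generator of `Fix(H)` is a proper component of `f` on the
right.»; p0007: «From this group we can compute a proper component of `f` as in the proof of Theorem 8, obtaining
`f = g(h)`».  («unfortunately, it is not true in general that `[K(x) : K(f)] = |G(f)|`», p0005.)

## What is proved (`K` ANY field unless `2 ≠ 0` / `char K = 2` is stated; `Γ = RatFunc K ≃ₐ[K] RatFunc K`,
## `G(f) = (K(f)).fixingSubgroup`, `u = RatFunc.X`)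

* §1 **`exists_rightFactor_of_le_fixingSubgroup`** (a finite `H ≤ G(f)` yields `f = g ∘ h` with `Fix(H) = K(h)` and
  `deg h = |H|`), **`not_isCoatom_of_subgroup_card_lt`** (`1 < |H| < deg f ⟹ f` decomposable),
  `not_isCoatom_of_card_fixingSubgroup_lt` (`1 < |G(f)| < deg f ⟹ f` decomposable).
* §2 `exists_algEquiv_apply_X_eq` (every Möbius `μ`, `deg μ = 1`, is `σ(u)` for some `σ ∈ Γ`), the units `−u`,
  `u⁻¹`, `−u⁻¹` (`max_natDegree_neg_X`, `max_natDegree_inv_X`, `max_natDegree_neg_inv_X`), `X_sq_ne_C_apply`, and the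
  degree `max_natDegree_X_sq_add_inv_sq` (`deg(u² + u⁻²) = 4`).
* §3 (`2 ≠ 0` in `K`) **`coe_fixingSubgroup_adjoin_X_sq_add_inv_sq`** (`G(u² + u⁻²) = {σ : σ(u) ∈ {u, −u, u⁻¹, −u⁻¹}}`
  EXACTLY — `⊇` by substitution, `=` because `|G(f)| ≤ deg f = 4`), **`card_fixingSubgroup_adjoin_X_sq_add_inv_sq`**
  (`= 4`), **`isGalois_adjoin_X_sq_add_inv_sq`** (`K(u)/K(u² + u⁻²)` is Galois, by Thm 7 (ii)).
* §4 `coe_fixingSubgroup_adjoin_X_sq` (`2 ≠ 0`: `G(u²) = {σ : σ(u) = ±u}`), `card_fixingSubgroup_adjoin_X_sq` (`= 2`),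
  `isGalois_adjoin_X_sq`; in characteristic `2`: **`fixingSubgroup_adjoin_X_sq_eq_bot_of_charTwo`** (`G(u²) = 1`:
  `(σu − u)² = σ(u²) − u² = 0`), **`not_isGalois_adjoin_X_sq_of_charTwo`** (`|G(u²)| = 1 < 2 = deg`: «it is not true in
  general that `[K(x) : K(f)] = |G(f)|`»).
-/

noncomputable section

open Polynomial IntermediateField

namespace Literature.FieldTheory.FunctionField

variable {K : Type*} [Field K]

/-! ### §1. Right components from finite subgroups of `G(f)` -/

/-- **A finite subgroup `H ≤ G(f)` yields a right component: `f = g ∘ h` with `Fix(H) = K(h)` and `deg h = |H|`**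
(`K(f) ≤ Fix(H)` because `H` fixes `f`; «any generator of `Fix(H)` is a proper component of `f` on the right»).
[cite: GutierrezSevilla2008, §3 Thm 8 (proof), Thm 6 (ii)] -/
theorem exists_rightFactor_of_le_fixingSubgroup {f : RatFunc K}
    (H : Subgroup (RatFunc K ≃ₐ[K] RatFunc K)) [Finite H]
    (hH : H ≤ (IntermediateField.adjoin K ({f} : Set (RatFunc K))).fixingSubgroup) :
    ∃ (h : RatFunc K) (hh : ¬ ∃ c, h = RatFunc.C c) (g : RatFunc K),
      f = ratFuncSubst h hh g ∧ IntermediateField.fixedField H = IntermediateField.adjoin K ({h} : Set (RatFunc K)) ∧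
        max h.num.natDegree h.denom.natDegree = Nat.card H := by
  obtain ⟨h, hh, hFix, hdeg⟩ := exists_fixedField_eq_adjoin H
  have hle : IntermediateField.adjoin K ({f} : Set (RatFunc K)) ≤ IntermediateField.adjoin K ({h} : Set (RatFunc K)) := by
    rw [← hFix]
    exact (IntermediateField.le_iff_le _ _).mpr hH
  obtain ⟨g, hg⟩ := (adjoin_le_adjoin_iff_exists_ratFuncSubst h hh f).mp hle
  exact ⟨h, hh, g, hg, hFix, hdeg⟩

/-- **`1 < |H| < deg f` for a (finite) `H ≤ G(f)` ⟹ `f` is decomposable** (`K(f) ⊊ Fix(H) = K(h) ⊊ K(u)`).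
[cite: GutierrezSevilla2008, §3 Thm 8 (proof)] -/
theorem not_isCoatom_of_subgroup_card_lt {f : RatFunc K}
    (H : Subgroup (RatFunc K ≃ₐ[K] RatFunc K)) [Finite H]
    (hH : H ≤ (IntermediateField.adjoin K ({f} : Set (RatFunc K))).fixingSubgroup)
    (h1 : 1 < Nat.card H) (h2 : Nat.card H < max f.num.natDegree f.denom.natDegree) :
    ¬ IsCoatom (IntermediateField.adjoin K ({f} : Set (RatFunc K))) := by
  intro hco
  have hle : IntermediateField.adjoin K ({f} : Set (RatFunc K)) ≤ IntermediateField.fixedField H :=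
    (IntermediateField.le_iff_le _ _).mpr hH
  have hfin := finrank_fixedField_eq_card_of_finite H
  rcases hco.le_iff.mp hle with htop | heq
  · rw [htop, IntermediateField.finrank_top] at hfin
    omega
  · rw [heq, RatFunc.finrank_eq_max_natDegree] at hfin
    omega

/-- **`1 < |G(f)| < deg f` ⟹ `f` is decomposable** («If `1 < |G(f)| < deg f`, we have `K(f) ⊊ K(Fix(G(f))) ⊊ K(x)`»).
[cite: GutierrezSevilla2008, §3 Thm 8 (proof of (i))] -/
theorem not_isCoatom_of_card_fixingSubgroup_lt {f : RatFunc K} (hf : ¬ ∃ c, f = RatFunc.C c)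
    (h1 : 1 < Nat.card (IntermediateField.adjoin K ({f} : Set (RatFunc K))).fixingSubgroup)
    (h2 : Nat.card (IntermediateField.adjoin K ({f} : Set (RatFunc K))).fixingSubgroup <
      max f.num.natDegree f.denom.natDegree) :
    ¬ IsCoatom (IntermediateField.adjoin K ({f} : Set (RatFunc K))) := by
  haveI := finite_fixingSubgroup_adjoin hf
  exact not_isCoatom_of_subgroup_card_lt _ le_rfl h1 h2

/-! ### §2. Units as automorphisms: `−u`, `u⁻¹`, `−u⁻¹`; the degree of `u² + u⁻²` -/

/-- **Every Möbius function `μ` (`deg μ = 1`) is `σ(u)` for a `K`-automorphism `σ` of `K(u)`** (`σ = σ_μ : g ↦ g ∘ μ` is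
bijective). [cite: GutierrezSevilla2008, §3 (Γ(K) = Möbius transformations = units of K(x))] -/
theorem exists_algEquiv_apply_X_eq (μ : RatFunc K) (hμ : max μ.num.natDegree μ.denom.natDegree = 1) :
    ∃ σ : RatFunc K ≃ₐ[K] RatFunc K, σ RatFunc.X = μ := by
  have hμc : ¬ ∃ c, μ = RatFunc.C c := fun h => by
    have h0 := (RatFunc.eq_C_iff μ).mp h
    rw [h0.1, h0.2, max_self] at hμ
    exact zero_ne_one hμ
  refine ⟨AlgEquiv.ofBijective (ratFuncSubst μ hμc)
    ⟨ratFuncSubst_injective μ hμc, (ratFuncSubst_surjective_iff μ hμc).mpr hμ⟩, ?_⟩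
  rw [AlgEquiv.ofBijective_apply, ratFuncSubst_X]

/-- `deg(−u) = 1`. [cite: GutierrezSevilla2008, §3 Def. 4 example (i)] -/
theorem max_natDegree_neg_X :
    max (-(RatFunc.X : RatFunc K)).num.natDegree (-(RatFunc.X : RatFunc K)).denom.natDegree = 1 := by
  rw [← RatFunc.algebraMap_X, ← map_neg, RatFunc.num_algebraMap, RatFunc.denom_algebraMap, natDegree_neg,
    natDegree_X, natDegree_one, Nat.max_eq_left zero_le_one]

/-- `deg(u⁻¹) = 1`. [cite: GutierrezSevilla2008, §3 Def. 4 example (i)] -/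
theorem max_natDegree_inv_X :
    max ((RatFunc.X : RatFunc K)⁻¹).num.natDegree ((RatFunc.X : RatFunc K)⁻¹).denom.natDegree = 1 := by
  obtain ⟨h1, h2⟩ := natDegree_num_inv_and_denom_inv (RatFunc.X_ne_zero (K := K))
  rw [h1, h2, RatFunc.num_X, RatFunc.denom_X, natDegree_one, natDegree_X, Nat.max_eq_right zero_le_one]

/-- `deg(−u⁻¹) = 1`. [cite: GutierrezSevilla2008, §3 Def. 4 example (i)] -/
theorem max_natDegree_neg_inv_X :
    max (-(RatFunc.X : RatFunc K)⁻¹).num.natDegree (-(RatFunc.X : RatFunc K)⁻¹).denom.natDegree = 1 := by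
  have hne : (-(RatFunc.X : RatFunc K)) ≠ 0 := neg_ne_zero.mpr RatFunc.X_ne_zero
  obtain ⟨h1, h2⟩ := natDegree_num_inv_and_denom_inv hne
  rw [← neg_inv] at h1 h2
  rw [h1, h2, ← RatFunc.algebraMap_X, ← map_neg, RatFunc.num_algebraMap, RatFunc.denom_algebraMap, natDegree_neg,
    natDegree_one, natDegree_X, Nat.max_eq_right zero_le_one]

/-- `u²` is not a constant: `u² ≠ c` (g26-#1 `X_sq_ne_C`, pointwise). [cite: GutierrezSevilla2008, Def. 1 (deg)] -/
theorem X_sq_ne_C_apply (c : K) : (RatFunc.X : RatFunc K) ^ 2 ≠ RatFunc.C c := fun h =>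
  X_sq_ne_C (K := K) ⟨c, h⟩

/-- **`deg(u² + u⁻²) = 4`**: `u² + u⁻² = (u⁴ + 1)/u²` in lowest terms. [cite: GutierrezSevilla2008, §3 Def. 4 example (i)] -/
theorem max_natDegree_X_sq_add_inv_sq :
    max ((RatFunc.X : RatFunc K) ^ 2 + ((RatFunc.X : RatFunc K) ^ 2)⁻¹).num.natDegree
        ((RatFunc.X : RatFunc K) ^ 2 + ((RatFunc.X : RatFunc K) ^ 2)⁻¹).denom.natDegree = 4 := by
  have hX : (RatFunc.X : RatFunc K) ≠ 0 := RatFunc.X_ne_zero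
  have hf : (RatFunc.X : RatFunc K) ^ 2 + ((RatFunc.X : RatFunc K) ^ 2)⁻¹ =
      algebraMap K[X] (RatFunc K) (Polynomial.X ^ 4 + Polynomial.C 1) /
        algebraMap K[X] (RatFunc K) (Polynomial.X ^ 2) := by
    rw [eq_div_iff (RatFunc.algebraMap_ne_zero (pow_ne_zero 2 Polynomial.X_ne_zero)), map_add, map_pow,
      RatFunc.algebraMap_X, RatFunc.algebraMap_C, map_one, map_pow, RatFunc.algebraMap_X, add_mul,
      inv_mul_cancel₀ (pow_ne_zero 2 hX)]
    ring
  have hcop : IsCoprime (Polynomial.X ^ 4 + Polynomial.C (1 : K)) (Polynomial.X ^ 2) :=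
    ⟨1, -Polynomial.X ^ 2, by rw [map_one]; ring⟩
  rw [hf, num_div_eq_of_isCoprime hcop (monic_X_pow 2), denom_div_eq_of_isCoprime hcop (monic_X_pow 2),
    natDegree_X_pow_add_C, natDegree_X_pow]
  decide

/-- `u² + u⁻²` is not constant. [cite: GutierrezSevilla2008, §3 Def. 4 example (i)] -/
theorem X_sq_add_inv_sq_ne_C : ¬ ∃ c, (RatFunc.X : RatFunc K) ^ 2 + ((RatFunc.X : RatFunc K) ^ 2)⁻¹ = RatFunc.C c :=
  fun h => by
    have h4 := max_natDegree_X_sq_add_inv_sq (K := K)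
    rw [Nat.max_eq_zero_iff.mpr ((RatFunc.eq_C_iff _).mp h)] at h4
    exact absurd h4 (by decide)

/-! ### §3. The example `G(u² + u⁻²) = {u, −u, 1/u, −1/u}` (`2 ≠ 0` in `K`) -/

section Example

variable (h2 : (2 : K) ≠ 0)
include h2

/-- `u ≠ −u` when `2 ≠ 0`. [cite: GutierrezSevilla2008, §3 Def. 4 example (i)] -/
theorem X_ne_neg_X : (RatFunc.X : RatFunc K) ≠ -RatFunc.X := fun h => by
  have h' : (RatFunc.C (2 : K)) * RatFunc.X = 0 := by rw [map_ofNat, two_mul]; nth_rewrite 1 [h]; rw [neg_add_cancel]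
  rcases mul_eq_zero.mp h' with h0 | h0
  · exact h2 ((map_eq_zero_iff _ RatFunc.C_injective).mp h0)
  · exact RatFunc.X_ne_zero h0

omit h2 in
/-- `u ≠ u⁻¹` (`u² ≠ 1`). [cite: GutierrezSevilla2008, §3 Def. 4 example (i)] -/
theorem X_ne_inv_X : (RatFunc.X : RatFunc K) ≠ RatFunc.X⁻¹ := fun h => by
  have h' : (RatFunc.X : RatFunc K) ^ 2 = RatFunc.C 1 := by
    rw [map_one, pow_two]; nth_rewrite 2 [h]; rw [mul_inv_cancel₀ RatFunc.X_ne_zero]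
  exact X_sq_ne_C_apply 1 h'

omit h2 in
/-- `u ≠ −u⁻¹` (`u² ≠ −1`). [cite: GutierrezSevilla2008, §3 Def. 4 example (i)] -/
theorem X_ne_neg_inv_X : (RatFunc.X : RatFunc K) ≠ -RatFunc.X⁻¹ := fun h => by
  have h' : (RatFunc.X : RatFunc K) ^ 2 = RatFunc.C (-1) := by
    rw [map_neg, map_one, pow_two]; nth_rewrite 2 [h]; rw [mul_neg, mul_inv_cancel₀ RatFunc.X_ne_zero]
  exact X_sq_ne_C_apply (-1) h'

omit h2 in
/-- `−u ≠ u⁻¹` (`u² ≠ −1`). [cite: GutierrezSevilla2008, §3 Def. 4 example (i)] -/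
theorem neg_X_ne_inv_X : -(RatFunc.X : RatFunc K) ≠ RatFunc.X⁻¹ := fun h => by
  have h' : (RatFunc.X : RatFunc K) = -RatFunc.X⁻¹ := by rw [← h, neg_neg]
  exact X_ne_neg_inv_X h'

/-- **«Let `f = x² + 1/x²`. Then `G(f) = {x, −x, 1/x, −1/x}`»** — EXACTLY, over any field with `2 ≠ 0`: the four
units fix `f` (substitution), they are distinct, and `|G(f)| ≤ deg f = 4` (Thm 7 (i)) leaves no room for more.
[cite: GutierrezSevilla2008, §3 Def. 4 example (i), Thm 7 (i)] -/
theorem coe_fixingSubgroup_adjoin_X_sq_add_inv_sq :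
    ((IntermediateField.adjoin K
        ({(RatFunc.X : RatFunc K) ^ 2 + ((RatFunc.X : RatFunc K) ^ 2)⁻¹} : Set (RatFunc K))).fixingSubgroup :
          Set (RatFunc K ≃ₐ[K] RatFunc K)) =
      {σ | σ RatFunc.X = RatFunc.X ∨ σ RatFunc.X = -RatFunc.X ∨ σ RatFunc.X = RatFunc.X⁻¹ ∨
        σ RatFunc.X = -RatFunc.X⁻¹} := by
  classical
  set f : RatFunc K := RatFunc.X ^ 2 + (RatFunc.X ^ 2)⁻¹ with hfdef
  set G := (IntermediateField.adjoin K ({f} : Set (RatFunc K))).fixingSubgroup with hG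
  -- the substitution computation: `σ f = (σ u)² + ((σ u)²)⁻¹`
  have hσf : ∀ σ : RatFunc K ≃ₐ[K] RatFunc K, σ f = (σ RatFunc.X) ^ 2 + ((σ RatFunc.X) ^ 2)⁻¹ := fun σ => by
    rw [hfdef, map_add, map_inv₀, map_pow]
  -- `⊇`: the four units fix `f`
  have hsub : {σ : RatFunc K ≃ₐ[K] RatFunc K | σ RatFunc.X = RatFunc.X ∨ σ RatFunc.X = -RatFunc.X ∨
      σ RatFunc.X = RatFunc.X⁻¹ ∨ σ RatFunc.X = -RatFunc.X⁻¹} ⊆ (G : Set (RatFunc K ≃ₐ[K] RatFunc K)) := by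
    intro σ hσ
    rw [SetLike.mem_coe, hG, mem_fixingSubgroup_adjoin_iff, hσf]
    rcases hσ with h | h | h | h
    · rw [h]
    · rw [h, neg_sq]
    · rw [h, inv_pow, inv_inv, add_comm]
    · rw [h, neg_sq, inv_pow, inv_inv, add_comm]
  refine le_antisymm ?_ hsub
  -- four distinct members
  obtain ⟨σ₂, hσ₂⟩ := exists_algEquiv_apply_X_eq (-(RatFunc.X : RatFunc K)) max_natDegree_neg_X
  obtain ⟨σ₃, hσ₃⟩ := exists_algEquiv_apply_X_eq ((RatFunc.X : RatFunc K)⁻¹) max_natDegree_inv_X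
  obtain ⟨σ₄, hσ₄⟩ := exists_algEquiv_apply_X_eq (-(RatFunc.X : RatFunc K)⁻¹) max_natDegree_neg_inv_X
  have h12 : (1 : RatFunc K ≃ₐ[K] RatFunc K) ≠ σ₂ := fun h => X_ne_neg_X h2 (by rw [← hσ₂, ← h, AlgEquiv.one_apply])
  have h13 : (1 : RatFunc K ≃ₐ[K] RatFunc K) ≠ σ₃ := fun h => X_ne_inv_X (K := K) (by rw [← hσ₃, ← h, AlgEquiv.one_apply])
  have h14 : (1 : RatFunc K ≃ₐ[K] RatFunc K) ≠ σ₄ := fun h =>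
    X_ne_neg_inv_X (K := K) (by rw [← hσ₄, ← h, AlgEquiv.one_apply])
  have h23 : σ₂ ≠ σ₃ := fun h => neg_X_ne_inv_X (K := K) (by rw [← hσ₂, ← hσ₃, h])
  have h24 : σ₂ ≠ σ₄ := fun h => X_ne_inv_X (K := K) (neg_injective (by rw [← hσ₂, ← hσ₄, h]))
  have h34 : σ₃ ≠ σ₄ := fun h => by
    have e : (RatFunc.X : RatFunc K)⁻¹ = (-RatFunc.X)⁻¹ := by rw [← hσ₃, h, hσ₄, neg_inv]
    exact X_ne_neg_X h2 (inv_injective e)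
  set T : Finset (RatFunc K ≃ₐ[K] RatFunc K) := {1, σ₂, σ₃, σ₄} with hT
  have hTcard : T.card = 4 := by
    rw [hT, Finset.card_insert_of_notMem, Finset.card_insert_of_notMem, Finset.card_insert_of_notMem,
      Finset.card_singleton]
    · simpa using h34
    · simp [h23, h24]
    · simp [h12, h13, h14]
  have hTsub : (↑T : Set (RatFunc K ≃ₐ[K] RatFunc K)) ⊆ (G : Set (RatFunc K ≃ₐ[K] RatFunc K)) := by
    intro σ hσ
    apply hsub
    simp only [hT, Finset.coe_insert, Finset.coe_singleton, Set.mem_insert_iff, Set.mem_singleton_iff] at hσ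
    rcases hσ with rfl | rfl | rfl | rfl
    · exact Or.inl (AlgEquiv.one_apply _)
    · exact Or.inr (Or.inl hσ₂)
    · exact Or.inr (Or.inr (Or.inl hσ₃))
    · exact Or.inr (Or.inr (Or.inr hσ₄))
  -- `|G(f)| ≤ deg f = 4`, so `G = T`
  have hf : ¬ ∃ c, f = RatFunc.C c := X_sq_add_inv_sq_ne_C
  haveI := finite_fixingSubgroup_adjoin hf
  have hcardG : (G : Set (RatFunc K ≃ₐ[K] RatFunc K)).ncard ≤ 4 := by
    rw [← Nat.card_coe_set_eq, ← max_natDegree_X_sq_add_inv_sq (K := K)]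
    exact card_fixingSubgroup_adjoin_le hf
  have hGT : (↑T : Set (RatFunc K ≃ₐ[K] RatFunc K)) = (G : Set (RatFunc K ≃ₐ[K] RatFunc K)) :=
    Set.eq_of_subset_of_ncard_le hTsub (by rw [Set.ncard_coe_finset, hTcard]; exact hcardG) (Set.toFinite _)
  -- conclude `G ⊆ S`
  intro σ hσ
  rw [← hGT] at hσ
  simp only [hT, Finset.coe_insert, Finset.coe_singleton, Set.mem_insert_iff, Set.mem_singleton_iff] at hσ
  rcases hσ with rfl | rfl | rfl | rfl
  · exact Or.inl (AlgEquiv.one_apply _)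
  · exact Or.inr (Or.inl hσ₂)
  · exact Or.inr (Or.inr (Or.inl hσ₃))
  · exact Or.inr (Or.inr (Or.inr hσ₄))

/-- **`|G(u² + u⁻²)| = 4 = deg(u² + u⁻²)`.** [cite: GutierrezSevilla2008, §3 Def. 4 example (i), Thm 7 (i)] -/
theorem card_fixingSubgroup_adjoin_X_sq_add_inv_sq :
    Nat.card (IntermediateField.adjoin K
        ({(RatFunc.X : RatFunc K) ^ 2 + ((RatFunc.X : RatFunc K) ^ 2)⁻¹} : Set (RatFunc K))).fixingSubgroup = 4 := by
  classical
  have hf : ¬ ∃ c, (RatFunc.X : RatFunc K) ^ 2 + ((RatFunc.X : RatFunc K) ^ 2)⁻¹ = RatFunc.C c := X_sq_add_inv_sq_ne_C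
  haveI := finite_fixingSubgroup_adjoin hf
  refine le_antisymm (by simpa only [max_natDegree_X_sq_add_inv_sq] using card_fixingSubgroup_adjoin_le hf) ?_
  -- four distinct elements, as in the previous proof
  obtain ⟨σ₂, hσ₂⟩ := exists_algEquiv_apply_X_eq (-(RatFunc.X : RatFunc K)) max_natDegree_neg_X
  obtain ⟨σ₃, hσ₃⟩ := exists_algEquiv_apply_X_eq ((RatFunc.X : RatFunc K)⁻¹) max_natDegree_inv_X
  obtain ⟨σ₄, hσ₄⟩ := exists_algEquiv_apply_X_eq (-(RatFunc.X : RatFunc K)⁻¹) max_natDegree_neg_inv_X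
  have h12 : (1 : RatFunc K ≃ₐ[K] RatFunc K) ≠ σ₂ := fun h => X_ne_neg_X h2 (by rw [← hσ₂, ← h, AlgEquiv.one_apply])
  have h13 : (1 : RatFunc K ≃ₐ[K] RatFunc K) ≠ σ₃ := fun h => X_ne_inv_X (K := K) (by rw [← hσ₃, ← h, AlgEquiv.one_apply])
  have h14 : (1 : RatFunc K ≃ₐ[K] RatFunc K) ≠ σ₄ := fun h =>
    X_ne_neg_inv_X (K := K) (by rw [← hσ₄, ← h, AlgEquiv.one_apply])
  have h23 : σ₂ ≠ σ₃ := fun h => neg_X_ne_inv_X (K := K) (by rw [← hσ₂, ← hσ₃, h])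
  have h24 : σ₂ ≠ σ₄ := fun h => X_ne_inv_X (K := K) (neg_injective (by rw [← hσ₂, ← hσ₄, h]))
  have h34 : σ₃ ≠ σ₄ := fun h => by
    have e : (RatFunc.X : RatFunc K)⁻¹ = (-RatFunc.X)⁻¹ := by rw [← hσ₃, h, hσ₄, neg_inv]
    exact X_ne_neg_X h2 (inv_injective e)
  set T : Finset (RatFunc K ≃ₐ[K] RatFunc K) := {1, σ₂, σ₃, σ₄} with hT
  have hTcard : T.card = 4 := by
    rw [hT, Finset.card_insert_of_notMem, Finset.card_insert_of_notMem, Finset.card_insert_of_notMem,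
      Finset.card_singleton]
    · simpa using h34
    · simp [h23, h24]
    · simp [h12, h13, h14]
  have hTsub : (↑T : Set (RatFunc K ≃ₐ[K] RatFunc K)) ⊆
      ((IntermediateField.adjoin K ({(RatFunc.X : RatFunc K) ^ 2 + ((RatFunc.X : RatFunc K) ^ 2)⁻¹} :
        Set (RatFunc K))).fixingSubgroup : Set (RatFunc K ≃ₐ[K] RatFunc K)) := by
    rw [coe_fixingSubgroup_adjoin_X_sq_add_inv_sq h2]
    intro σ hσ
    simp only [hT, Finset.coe_insert, Finset.coe_singleton, Set.mem_insert_iff, Set.mem_singleton_iff] at hσ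
    rcases hσ with rfl | rfl | rfl | rfl
    · exact Or.inl (AlgEquiv.one_apply _)
    · exact Or.inr (Or.inl hσ₂)
    · exact Or.inr (Or.inr (Or.inl hσ₃))
    · exact Or.inr (Or.inr (Or.inr hσ₄))
  calc 4 = (↑T : Set (RatFunc K ≃ₐ[K] RatFunc K)).ncard := by rw [Set.ncard_coe_finset, hTcard]
    _ ≤ _ := by
      rw [← Nat.card_coe_set_eq]
      exact Set.ncard_le_ncard hTsub (Set.toFinite _)

/-- **`K(u)/K(u² + u⁻²)` is Galois** (degree `4`, `|G(f)| = deg f`, Theorem 7 (ii)). [cite: GutierrezSevilla2008, §3 Thm 7 (ii), Def. 4 example (i)] -/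
theorem isGalois_adjoin_X_sq_add_inv_sq :
    IsGalois (IntermediateField.adjoin K
      ({(RatFunc.X : RatFunc K) ^ 2 + ((RatFunc.X : RatFunc K) ^ 2)⁻¹} : Set (RatFunc K))) (RatFunc K) := by
  refine (card_fixingSubgroup_adjoin_eq_iff_isGalois X_sq_add_inv_sq_ne_C).mp ?_
  rw [card_fixingSubgroup_adjoin_X_sq_add_inv_sq h2, max_natDegree_X_sq_add_inv_sq]

end Example

/-! ### §4. The example `G(u²)`: `{u, −u}` when `2 ≠ 0`, trivial in characteristic `2` -/

/-- **`G(u²) = {σ : σ(u) = ±u}`** when `2 ≠ 0` (`⊇` by `(−u)² = u²`; `=` by `|G(u²)| ≤ deg u² = 2`).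
[cite: GutierrezSevilla2008, §3 Thm 7 (i), (ii)] -/
theorem coe_fixingSubgroup_adjoin_X_sq (h2 : (2 : K) ≠ 0) :
    ((IntermediateField.adjoin K ({(RatFunc.X : RatFunc K) ^ 2} : Set (RatFunc K))).fixingSubgroup :
        Set (RatFunc K ≃ₐ[K] RatFunc K)) =
      {σ | σ RatFunc.X = RatFunc.X ∨ σ RatFunc.X = -RatFunc.X} := by
  classical
  set G := (IntermediateField.adjoin K ({(RatFunc.X : RatFunc K) ^ 2} : Set (RatFunc K))).fixingSubgroup with hG
  have hsub : {σ : RatFunc K ≃ₐ[K] RatFunc K | σ RatFunc.X = RatFunc.X ∨ σ RatFunc.X = -RatFunc.X} ⊆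
      (G : Set (RatFunc K ≃ₐ[K] RatFunc K)) := by
    intro σ hσ
    rw [SetLike.mem_coe, hG, mem_fixingSubgroup_adjoin_iff, map_pow]
    rcases hσ with h | h
    · rw [h]
    · rw [h, neg_sq]
  refine le_antisymm ?_ hsub
  obtain ⟨σ₂, hσ₂⟩ := exists_algEquiv_apply_X_eq (-(RatFunc.X : RatFunc K)) max_natDegree_neg_X
  have h12 : (1 : RatFunc K ≃ₐ[K] RatFunc K) ≠ σ₂ := fun h => X_ne_neg_X h2 (by rw [← hσ₂, ← h, AlgEquiv.one_apply])
  set T : Finset (RatFunc K ≃ₐ[K] RatFunc K) := {1, σ₂} with hT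
  have hTcard : T.card = 2 := by
    rw [hT, Finset.card_insert_of_notMem (by simpa using h12), Finset.card_singleton]
  have hTsub : (↑T : Set (RatFunc K ≃ₐ[K] RatFunc K)) ⊆ (G : Set (RatFunc K ≃ₐ[K] RatFunc K)) := by
    intro σ hσ
    apply hsub
    simp only [hT, Finset.coe_insert, Finset.coe_singleton, Set.mem_insert_iff, Set.mem_singleton_iff] at hσ
    rcases hσ with rfl | rfl
    · exact Or.inl (AlgEquiv.one_apply _)
    · exact Or.inr hσ₂
  have hf : ¬ ∃ c, (RatFunc.X : RatFunc K) ^ 2 = RatFunc.C c := X_sq_ne_C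
  haveI := finite_fixingSubgroup_adjoin hf
  have hcardG : (G : Set (RatFunc K ≃ₐ[K] RatFunc K)).ncard ≤ 2 := by
    rw [← Nat.card_coe_set_eq, ← max_natDegree_X_sq (K := K)]
    exact card_fixingSubgroup_adjoin_le hf
  have hGT : (↑T : Set (RatFunc K ≃ₐ[K] RatFunc K)) = (G : Set (RatFunc K ≃ₐ[K] RatFunc K)) :=
    Set.eq_of_subset_of_ncard_le hTsub (by rw [Set.ncard_coe_finset, hTcard]; exact hcardG) (Set.toFinite _)
  intro σ hσ
  rw [← hGT] at hσ
  simp only [hT, Finset.coe_insert, Finset.coe_singleton, Set.mem_insert_iff, Set.mem_singleton_iff] at hσ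
  rcases hσ with rfl | rfl
  · exact Or.inl (AlgEquiv.one_apply _)
  · exact Or.inr hσ₂

/-- **`|G(u²)| = 2 = deg u²`** when `2 ≠ 0`. [cite: GutierrezSevilla2008, §3 Thm 7 (i), (ii)] -/
theorem card_fixingSubgroup_adjoin_X_sq (h2 : (2 : K) ≠ 0) :
    Nat.card (IntermediateField.adjoin K ({(RatFunc.X : RatFunc K) ^ 2} : Set (RatFunc K))).fixingSubgroup = 2 := by
  classical
  have hf : ¬ ∃ c, (RatFunc.X : RatFunc K) ^ 2 = RatFunc.C c := X_sq_ne_C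
  haveI := finite_fixingSubgroup_adjoin hf
  refine le_antisymm (by simpa only [max_natDegree_X_sq] using card_fixingSubgroup_adjoin_le hf) ?_
  obtain ⟨σ₂, hσ₂⟩ := exists_algEquiv_apply_X_eq (-(RatFunc.X : RatFunc K)) max_natDegree_neg_X
  have h12 : (1 : RatFunc K ≃ₐ[K] RatFunc K) ≠ σ₂ := fun h => X_ne_neg_X h2 (by rw [← hσ₂, ← h, AlgEquiv.one_apply])
  set T : Finset (RatFunc K ≃ₐ[K] RatFunc K) := {1, σ₂} with hT
  have hTcard : T.card = 2 := by
    rw [hT, Finset.card_insert_of_notMem (by simpa using h12), Finset.card_singleton]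
  have hTsub : (↑T : Set (RatFunc K ≃ₐ[K] RatFunc K)) ⊆
      ((IntermediateField.adjoin K ({(RatFunc.X : RatFunc K) ^ 2} : Set (RatFunc K))).fixingSubgroup :
        Set (RatFunc K ≃ₐ[K] RatFunc K)) := by
    rw [coe_fixingSubgroup_adjoin_X_sq h2]
    intro σ hσ
    simp only [hT, Finset.coe_insert, Finset.coe_singleton, Set.mem_insert_iff, Set.mem_singleton_iff] at hσ
    rcases hσ with rfl | rfl
    · exact Or.inl (AlgEquiv.one_apply _)
    · exact Or.inr hσ₂
  calc 2 = (↑T : Set (RatFunc K ≃ₐ[K] RatFunc K)).ncard := by rw [Set.ncard_coe_finset, hTcard]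
    _ ≤ _ := by
      rw [← Nat.card_coe_set_eq]
      exact Set.ncard_le_ncard hTsub (Set.toFinite _)

/-- **`K(u)/K(u²)` is Galois when `2 ≠ 0`** (Kummer; here via `|G(u²)| = deg u²`). [cite: GutierrezSevilla2008, §3 Thm 7 (ii)] -/
theorem isGalois_adjoin_X_sq (h2 : (2 : K) ≠ 0) :
    IsGalois (IntermediateField.adjoin K ({(RatFunc.X : RatFunc K) ^ 2} : Set (RatFunc K))) (RatFunc K) := by
  refine (card_fixingSubgroup_adjoin_eq_iff_isGalois X_sq_ne_C).mp ?_
  rw [card_fixingSubgroup_adjoin_X_sq h2, max_natDegree_X_sq]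

/-- **In characteristic `2`, `G(u²)` is trivial**: `σ(u)² = u²` gives `(σ(u) − u)² = σ(u)² − u² = 0`, so `σ(u) = u`.
[cite: GutierrezSevilla2008, §3 Thm 7 (ii) («if the extension is separable»), p0005 («it is not true in general that [K(x):K(f)] = |G(f)|»)] -/
theorem fixingSubgroup_adjoin_X_sq_eq_bot_of_charTwo [CharP K 2] :
    (IntermediateField.adjoin K ({(RatFunc.X : RatFunc K) ^ 2} : Set (RatFunc K))).fixingSubgroup = ⊥ := by
  rw [eq_bot_iff]
  intro σ hσ
  rw [mem_fixingSubgroup_adjoin_iff, map_pow] at hσ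
  rw [Subgroup.mem_bot]
  apply algEquiv_ext_of_apply_X_eq
  rw [AlgEquiv.one_apply]
  have hchar : (σ RatFunc.X - RatFunc.X) ^ 2 = σ RatFunc.X ^ 2 - RatFunc.X ^ 2 := sub_pow_char _ _
  have h : (σ RatFunc.X - RatFunc.X) ^ 2 = 0 := by rw [hchar, hσ, sub_self]
  exact sub_eq_zero.mp (pow_eq_zero_iff two_ne_zero |>.mp h)

/-- **In characteristic `2`, `K(u)/K(u²)` is NOT Galois** (`|G(u²)| = 1 < 2 = deg u²`; the extension is purely
inseparable). [cite: GutierrezSevilla2008, §3 Thm 7 (ii), p0005] -/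
theorem not_isGalois_adjoin_X_sq_of_charTwo [CharP K 2] :
    ¬ IsGalois (IntermediateField.adjoin K ({(RatFunc.X : RatFunc K) ^ 2} : Set (RatFunc K))) (RatFunc K) := by
  intro h
  have hc := (card_fixingSubgroup_adjoin_eq_iff_isGalois X_sq_ne_C).mpr h
  rw [fixingSubgroup_adjoin_X_sq_eq_bot_of_charTwo, max_natDegree_X_sq, Subgroup.card_bot] at hc
  exact absurd hc (by decide)

end Literature.FieldTheory.FunctionField
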